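import Summits.Ventures.PercRepro.S1SevenSixThreeSeven

/-!
# PercRepro — THE SHAPE `(rank 4 on 8) ⊕ (rank 3 on 5)` OF THE `(7, 6)` CELL (p2, gen 28; SUBCLAIM-S1 §6.10
(xvii)(o); the `(7, 6)` capstone is `S1SevenSixSeparators`)

`M` coloop-free of rank `4` on `8` points (a corank-`4` part), `N` coloop-free of rank `3` on `5` points, all pairs
of rank `2`. With `t, q₂` the rank-`2` sets of `M` with `3, 4` points, `q₃, s₄` its `4`-sets of rank `3, 4`,
`s₅, s₆` its spanning `5`- and `6`-sets: `N_M(4, 2) ≤ s₆ + t + q₂`, `N_M(4, 3) ≤ s₅ + q₃`, `N_M(4, 4) ≤ s₄` (the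
complement by size and rank), `#U ≤ 10 N_M(4, 2) + 5 N_M(4, 3) + N_M(4, 4)`; `f_M(2) ≥ 28 + t + q₂`,
`f_M(3) ≥ 56 − t + q₃`, `f_M(4) ≥ 9 + s₆ + s₅ + s₄`, `q₂ + q₃ + s₄ ≥ 70`; `#Y ≥ 13 f_M(2) + 23 f_M(3) + 15 f_M(4)`;
the incidence count gives `t ≤ 28`, `q₂ ≤ 14` (the closure of a pair has `≤ 5` points). Then
`Φ(7, 4) · #U ≤ #Y` with margin `≥ 650`. Nothing is claimed about any cell.

* the complement-by-size bounds and the profile of `M`;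
* `c025_seven_four_disjointSum_four_eight_three_five`.
Axioms: standard.
-/

open scoped Matroid

namespace PercRepro

namespace S1

open Set

variable {α : Type}

section RankFourOnEight

variable {M : Matroid α} [M.Finite]

/-- The standard size facts for a spanning set `A` of rank `4` with a complement of rank `k`. -/
theorem sizes_of_profileSet_four (hE : M.E.ncard = 8) {k : ℕ} {A : Set α} (hA : A ∈ profileSet M 4 k) :
    4 ≤ A.ncard ∧ k ≤ (M.E \ A).ncard ∧ A.ncard + (M.E \ A).ncard = 8 := by
  obtain ⟨hAE, hA4, hAc⟩ := hA
  have hAfin : A.Finite := M.ground_finite.subset hAE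
  have h1 : ((4 : ℕ) : ℕ∞) ≤ (A.ncard : ℕ∞) := by
    rw [← hA4, hAfin.cast_ncard_eq]; exact M.eRk_le_encard A
  have h2 : ((k : ℕ) : ℕ∞) ≤ ((M.E \ A).ncard : ℕ∞) := by
    rw [← hAc, (M.ground_finite.subset sdiff_subset).cast_ncard_eq]; exact M.eRk_le_encard _
  have h3 : A.ncard + (M.E \ A).ncard = M.E.ncard := by
    rw [← ncard_union_eq disjoint_sdiff_right hAfin (M.ground_finite.subset sdiff_subset), union_sdiff_cancel hAE]
  exact ⟨by exact_mod_cast h1, by exact_mod_cast h2, by rw [h3, hE]⟩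

/-- Complementation is injective on a profile set. -/
theorem injOn_compl_profileSet (M : Matroid α) (a k : ℕ) : InjOn (fun A => M.E \ A) (profileSet M a k) := by
  intro A hA A' hA' hAA
  have e : M.E \ A = M.E \ A' := hAA
  have := congrArg (fun S => M.E \ S) e
  simp only [sdiff_sdiff_cancel_left hA.1, sdiff_sdiff_cancel_left hA'.1] at this
  exact this

/-- `N_M(4, 2) ≤ s₆ + t + q₂`. -/
theorem ncard_profileSet_four_two_le_rank_four_eight (hM : M.eRank = ((4 : ℕ) : ℕ∞)) (hE : M.E.ncard = 8)
    (hcol : M.coloops = ∅) :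
    (profileSet M 4 2).ncard ≤ {Q : Set α | Q ⊆ M.E ∧ Q.ncard = 6 ∧ M.eRk Q = ((4 : ℕ) : ℕ∞)}.ncard +
      (rankTwoSets M 3).ncard + (rankTwoSets M 4).ncard := by
  have hS6 : {Q : Set α | Q ⊆ M.E ∧ Q.ncard = 6 ∧ M.eRk Q = ((4 : ℕ) : ℕ∞)}.Finite :=
    M.ground_finite.finite_subsets.subset (fun _ hA => hA.1)
  have hsub : profileSet M 4 2 ⊆ {Q : Set α | Q ⊆ M.E ∧ Q.ncard = 6 ∧ M.eRk Q = ((4 : ℕ) : ℕ∞)} ∪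
      (fun T => M.E \ T) '' rankTwoSets M 3 ∪ (fun T => M.E \ T) '' rankTwoSets M 4 := by
    intro A hA
    obtain ⟨h1, h2, h3⟩ := sizes_of_profileSet_four hE hA
    obtain ⟨hAE, hA4, hAc⟩ := hA
    -- the complement has rank `2`, hence at most `5` points (it misses at least `3`)
    have hc5 : (M.E \ A).ncard ≤ 5 := by
      have h := sub_add_one_le_ncard_ground_sdiff_of_coloops M hM hcol (X := M.E \ A) sdiff_subset hAc (by norm_num)
      rw [sdiff_sdiff_cancel_left hAE] at h
      omega
    rcases Nat.lt_or_ge (M.E \ A).ncard 3 with h | h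
    · left; left; exact ⟨hAE, by omega, hA4⟩
    rcases Nat.lt_or_ge (M.E \ A).ncard 4 with h' | h'
    · left; right; exact ⟨M.E \ A, ⟨sdiff_subset, by omega, hAc⟩, sdiff_sdiff_cancel_left hAE⟩
    · right; exact ⟨M.E \ A, ⟨sdiff_subset, by omega, hAc⟩, sdiff_sdiff_cancel_left hAE⟩
  have h := ncard_le_ncard hsub ((hS6.union ((rankTwoSets_finite M 3).image _)).union ((rankTwoSets_finite M 4).image _))
  refine h.trans ((ncard_union_le _ _).trans ?_)
  refine (Nat.add_le_add (ncard_union_le _ _) (ncard_image_le (rankTwoSets_finite M 4))).trans ?_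
  exact Nat.add_le_add_right (Nat.add_le_add_left (ncard_image_le (rankTwoSets_finite M 3)) _) _

/-- `N_M(4, 3) ≤ s₅ + q₃`. -/
theorem ncard_profileSet_four_three_le_rank_four_eight (hE : M.E.ncard = 8) :
    (profileSet M 4 3).ncard ≤ {Q : Set α | Q ⊆ M.E ∧ Q.ncard = 5 ∧ M.eRk Q = ((4 : ℕ) : ℕ∞)}.ncard +
      {Q : Set α | Q ⊆ M.E ∧ Q.ncard = 4 ∧ M.eRk Q = ((3 : ℕ) : ℕ∞)}.ncard := by
  have hS5 : {Q : Set α | Q ⊆ M.E ∧ Q.ncard = 5 ∧ M.eRk Q = ((4 : ℕ) : ℕ∞)}.Finite :=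
    M.ground_finite.finite_subsets.subset (fun _ hA => hA.1)
  have hQ3 : {Q : Set α | Q ⊆ M.E ∧ Q.ncard = 4 ∧ M.eRk Q = ((3 : ℕ) : ℕ∞)}.Finite :=
    M.ground_finite.finite_subsets.subset (fun _ hA => hA.1)
  have hsub : profileSet M 4 3 ⊆ {Q : Set α | Q ⊆ M.E ∧ Q.ncard = 5 ∧ M.eRk Q = ((4 : ℕ) : ℕ∞)} ∪
      (fun T => M.E \ T) '' {Q : Set α | Q ⊆ M.E ∧ Q.ncard = 4 ∧ M.eRk Q = ((3 : ℕ) : ℕ∞)} := by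
    intro A hA
    obtain ⟨h1, h2, h3⟩ := sizes_of_profileSet_four hE hA
    obtain ⟨hAE, hA4, hAc⟩ := hA
    rcases Nat.lt_or_ge (M.E \ A).ncard 4 with h | h
    · left; exact ⟨hAE, by omega, hA4⟩
    · right; exact ⟨M.E \ A, ⟨sdiff_subset, by omega, hAc⟩, sdiff_sdiff_cancel_left hAE⟩
  have h := ncard_le_ncard hsub (hS5.union (hQ3.image _))
  exact h.trans ((ncard_union_le _ _).trans (Nat.add_le_add_left (ncard_image_le hQ3) _))

/-- `N_M(4, 4) ≤ s₄`. -/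
theorem ncard_profileSet_four_four_le_rank_four_eight (hE : M.E.ncard = 8) :
    (profileSet M 4 4).ncard ≤ {Q : Set α | Q ⊆ M.E ∧ Q.ncard = 4 ∧ M.eRk Q = ((4 : ℕ) : ℕ∞)}.ncard := by
  have hS4 : {Q : Set α | Q ⊆ M.E ∧ Q.ncard = 4 ∧ M.eRk Q = ((4 : ℕ) : ℕ∞)}.Finite :=
    M.ground_finite.finite_subsets.subset (fun _ hA => hA.1)
  refine ncard_le_ncard (fun A hA => ?_) hS4
  obtain ⟨h1, h2, h3⟩ := sizes_of_profileSet_four hE hA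
  exact ⟨hA.1, by omega, hA.2.1⟩

/-- Every `4`-set has rank `2`, `3` or `4`: `q₂ + q₃ + s₄ ≥ 70`. -/
theorem seventy_le_four_sets_rank_four_eight (hM : M.eRank = ((4 : ℕ) : ℕ∞)) (hE : M.E.ncard = 8)
    (hpairs : ∀ e ∈ M.E, ∀ f ∈ M.E, e ≠ f → M.eRk {e, f} = 2) :
    70 ≤ (rankTwoSets M 4).ncard + {Q : Set α | Q ⊆ M.E ∧ Q.ncard = 4 ∧ M.eRk Q = ((3 : ℕ) : ℕ∞)}.ncard +
      {Q : Set α | Q ⊆ M.E ∧ Q.ncard = 4 ∧ M.eRk Q = ((4 : ℕ) : ℕ∞)}.ncard := by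
  have hf4 : {A : Set α | A ⊆ M.E ∧ A.ncard = 4}.Finite := M.ground_finite.finite_subsets.subset (fun _ hA => hA.1)
  have hsub : {A : Set α | A ⊆ M.E ∧ A.ncard = 4} ⊆ rankTwoSets M 4 ∪
      {Q : Set α | Q ⊆ M.E ∧ Q.ncard = 4 ∧ M.eRk Q = ((3 : ℕ) : ℕ∞)} ∪
      {Q : Set α | Q ⊆ M.E ∧ Q.ncard = 4 ∧ M.eRk Q = ((4 : ℕ) : ℕ∞)} := by
    rintro A ⟨hAE, h4⟩
    have hhi : M.eRk A ≤ M.eRank := M.eRk_le_eRank A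
    rw [hM] at hhi
    obtain ⟨n, hn⟩ := ENat.ne_top_iff_exists.mp (ne_top_of_le_ne_top (by decide) hhi)
    have hlo := two_le_eRk_of_two_le_ncard hpairs hAE (by omega)
    rw [← hn] at hlo hhi
    have hlo' : 2 ≤ n := by exact_mod_cast hlo
    have hhi' : n ≤ 4 := by exact_mod_cast hhi
    rcases Nat.lt_or_ge n 3 with h | h
    · left; left; refine ⟨hAE, h4, ?_⟩; rw [← hn]; have : n = 2 := by omega
      rw [this]; rfl
    rcases Nat.lt_or_ge n 4 with h' | h'
    · left; right; refine ⟨hAE, h4, ?_⟩; rw [← hn]; have : n = 3 := by omega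
      rw [this]
    · right; refine ⟨hAE, h4, ?_⟩; rw [← hn]; have : n = 4 := by omega
      rw [this]
  have h := ncard_le_ncard hsub (((rankTwoSets_finite M 4).union (hf4.subset (fun _ hA => ⟨hA.1, hA.2.1⟩))).union
    (hf4.subset (fun _ hA => ⟨hA.1, hA.2.1⟩)))
  rw [ncard_setOf_subset_ncard_eq M.ground_finite 4, hE, show Nat.choose 8 4 = 70 by decide] at h
  exact h.trans ((ncard_union_le _ _).trans (Nat.add_le_add_right (ncard_union_le _ _) _))

/-- `f(2) ≥ 28 + t + q₂`, `f(3) ≥ 56 − t + q₃`, `f(4) ≥ 9 + s₆ + s₅ + s₄`. -/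
theorem profile_rank_four_eight (hM : M.eRank = ((4 : ℕ) : ℕ∞)) (hE : M.E.ncard = 8) (hcol : M.coloops = ∅)
    (hpairs : ∀ e ∈ M.E, ∀ f ∈ M.E, e ≠ f → M.eRk {e, f} = 2) :
    28 + (rankTwoSets M 3).ncard + (rankTwoSets M 4).ncard ≤ (rankSet M 2).ncard ∧
    56 - (rankTwoSets M 3).ncard + {Q : Set α | Q ⊆ M.E ∧ Q.ncard = 4 ∧ M.eRk Q = ((3 : ℕ) : ℕ∞)}.ncard ≤
      (rankSet M 3).ncard ∧
    9 + {Q : Set α | Q ⊆ M.E ∧ Q.ncard = 6 ∧ M.eRk Q = ((4 : ℕ) : ℕ∞)}.ncard +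
      {Q : Set α | Q ⊆ M.E ∧ Q.ncard = 5 ∧ M.eRk Q = ((4 : ℕ) : ℕ∞)}.ncard +
      {Q : Set α | Q ⊆ M.E ∧ Q.ncard = 4 ∧ M.eRk Q = ((4 : ℕ) : ℕ∞)}.ncard ≤ (rankSet M 4).ncard := by
  have hf : ∀ k : ℕ, {A : Set α | A ⊆ M.E ∧ A.ncard = k}.Finite := fun k =>
    M.ground_finite.finite_subsets.subset (fun _ hA => hA.1)
  refine ⟨?_, ?_, ?_⟩
  · -- pairs, rank-`2` triples, rank-`2` four-sets
    have hsub : {A : Set α | A ⊆ M.E ∧ A.ncard = 2} ∪ rankTwoSets M 3 ∪ rankTwoSets M 4 ⊆ rankSet M 2 := by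
      rintro A ((⟨hAE, h2⟩ | ⟨hAE, -, h⟩) | ⟨hAE, -, h⟩)
      · refine ⟨hAE, ?_⟩
        obtain ⟨x, y, hxy, rfl⟩ := ncard_eq_two.mp h2
        rw [hpairs x (hAE (by simp)) y (hAE (by simp)) hxy]; rfl
      · exact ⟨hAE, h⟩
      · exact ⟨hAE, h⟩
    have h := ncard_le_ncard hsub (rankSet_finite M 2)
    rw [ncard_union_eq (by rw [Set.disjoint_left]; rintro A (⟨-, h2⟩ | ⟨-, h3, -⟩) ⟨-, h4, -⟩ <;> omega)
        ((hf 2).union (rankTwoSets_finite M 3)) (rankTwoSets_finite M 4),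
      ncard_union_eq (by rw [Set.disjoint_left]; rintro A ⟨-, h2⟩ ⟨-, h3, -⟩; omega) (hf 2) (rankTwoSets_finite M 3),
      ncard_setOf_subset_ncard_eq M.ground_finite 2, hE, show Nat.choose 8 2 = 28 by decide] at h
    exact h
  · -- the `3`-sets that are not rank-`2` triples, and the rank-`3` four-sets
    have hTsub : rankTwoSets M 3 ⊆ {A : Set α | A ⊆ M.E ∧ A.ncard = 3} := fun T hT => ⟨hT.1, hT.2.1⟩
    have hsub : ({A : Set α | A ⊆ M.E ∧ A.ncard = 3} \ rankTwoSets M 3) ∪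
        {Q : Set α | Q ⊆ M.E ∧ Q.ncard = 4 ∧ M.eRk Q = ((3 : ℕ) : ℕ∞)} ⊆ rankSet M 3 := by
      rintro A (⟨⟨hAE, h3⟩, hAT⟩ | ⟨hAE, -, h⟩)
      · refine ⟨hAE, ?_⟩
        have hhi : M.eRk A ≤ 3 := by
          have := M.eRk_le_encard A
          rwa [← (M.ground_finite.subset hAE).cast_ncard_eq, h3] at this
        have hlo := two_le_eRk_of_two_le_ncard hpairs hAE (by omega)
        obtain ⟨n, hn⟩ := ENat.ne_top_iff_exists.mp (ne_top_of_le_ne_top (by decide) hhi)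
        rw [← hn] at hlo hhi ⊢
        have hlo' : 2 ≤ n := by exact_mod_cast hlo
        have hhi' : n ≤ 3 := by exact_mod_cast hhi
        rcases Nat.lt_or_ge n 3 with h | h
        · exfalso; apply hAT; refine ⟨hAE, h3, ?_⟩; rw [← hn]; have : n = 2 := by omega
          rw [this]; rfl
        · have : n = 3 := by omega
          rw [this]
      · exact ⟨hAE, h⟩
    have h := ncard_le_ncard hsub (rankSet_finite M 3)
    rw [ncard_union_eq (by rw [Set.disjoint_left]; rintro A ⟨⟨-, h3⟩, -⟩ ⟨-, h4, -⟩; omega)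
        ((hf 3).subset sdiff_subset) ((hf 4).subset (fun _ hA => ⟨hA.1, hA.2.1⟩)),
      ncard_sdiff hTsub (rankTwoSets_finite M 3), ncard_setOf_subset_ncard_eq M.ground_finite 3, hE,
      show Nat.choose 8 3 = 56 by decide] at h
    exact h
  · -- `E`, the `7`-sets, the spanning `6`-, `5`-, `4`-sets
    have hsub : {M.E} ∪ {A : Set α | A ⊆ M.E ∧ A.ncard = 7} ∪
        {Q : Set α | Q ⊆ M.E ∧ Q.ncard = 6 ∧ M.eRk Q = ((4 : ℕ) : ℕ∞)} ∪
        {Q : Set α | Q ⊆ M.E ∧ Q.ncard = 5 ∧ M.eRk Q = ((4 : ℕ) : ℕ∞)} ∪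
        {Q : Set α | Q ⊆ M.E ∧ Q.ncard = 4 ∧ M.eRk Q = ((4 : ℕ) : ℕ∞)} ⊆ rankSet M 4 := by
      rintro A ((((hA | ⟨hAE, h7⟩) | ⟨hAE, -, h⟩) | ⟨hAE, -, h⟩) | ⟨hAE, -, h⟩)
      · rw [mem_singleton_iff] at hA; subst hA
        exact ⟨subset_rfl, by rw [M.eRk_ground, hM]⟩
      · refine ⟨hAE, ?_⟩
        -- a `7`-set spans: a rank-`k < 4` set misses at least `2` points
        have hhi : M.eRk A ≤ M.eRank := M.eRk_le_eRank A
        rw [hM] at hhi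
        obtain ⟨n, hn⟩ := ENat.ne_top_iff_exists.mp (ne_top_of_le_ne_top (by decide) hhi)
        rw [← hn] at hhi ⊢
        have hhi' : n ≤ 4 := by exact_mod_cast hhi
        rcases Nat.lt_or_ge n 4 with h | h
        · exfalso
          have hmiss := sub_add_one_le_ncard_ground_sdiff_of_coloops M hM hcol hAE hn.symm h
          rw [ncard_sdiff' hAE M.ground_finite, hE, h7] at hmiss
          omega
        · have : n = 4 := by omega
          rw [this]
      · exact ⟨hAE, h⟩
      · exact ⟨hAE, h⟩
      · exact ⟨hAE, h⟩
    have hS : ∀ k : ℕ, {Q : Set α | Q ⊆ M.E ∧ Q.ncard = k ∧ M.eRk Q = ((4 : ℕ) : ℕ∞)}.Finite := fun k =>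
      (hf k).subset (fun _ hA => ⟨hA.1, hA.2.1⟩)
    have h := ncard_le_ncard hsub (rankSet_finite M 4)
    rw [ncard_union_eq (by
          rw [Set.disjoint_left]
          rintro A (((hA | ⟨-, h7⟩) | ⟨-, h6, -⟩) | ⟨-, h5, -⟩) ⟨-, h4, -⟩
          · rw [mem_singleton_iff] at hA; subst hA; omega
          all_goals omega) ((((finite_singleton _).union (hf 7)).union (hS 6)).union (hS 5)) (hS 4),
      ncard_union_eq (by
          rw [Set.disjoint_left]
          rintro A ((hA | ⟨-, h7⟩) | ⟨-, h6, -⟩) ⟨-, h5, -⟩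
          · rw [mem_singleton_iff] at hA; subst hA; omega
          all_goals omega) (((finite_singleton _).union (hf 7)).union (hS 6)) (hS 5),
      ncard_union_eq (by
          rw [Set.disjoint_left]
          rintro A (hA | ⟨-, h7⟩) ⟨-, h6, -⟩
          · rw [mem_singleton_iff] at hA; subst hA; omega
          · omega) ((finite_singleton _).union (hf 7)) (hS 6),
      ncard_union_eq (by
          rw [Set.disjoint_left]
          rintro A hA ⟨-, h7⟩
          rw [mem_singleton_iff] at hA; subst hA; omega) (finite_singleton _) (hf 7),
      ncard_singleton, ncard_setOf_subset_ncard_eq M.ground_finite 7, hE, show Nat.choose 8 7 = 8 by decide] at h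
    omega

end RankFourOnEight

/-- The arithmetic of the shape `(rank 4 on 8) ⊕ (rank 3 on 5)` at `(7, 4)`. -/
theorem consumer_arith_four_eight_three_five {u y t q2 q3 s4 s5 s6 F2 F3 F4 : ℚ}
    (hU : u ≤ 10 * (s6 + t + q2) + 5 * (s5 + q3) + s4) (hY : 13 * F2 + 23 * F3 + 15 * F4 ≤ y)
    (hF2 : 28 + t + q2 ≤ F2) (hF3 : 56 - t + q3 ≤ F3) (hF4 : 9 + s6 + s5 + s4 ≤ F4)
    (h70 : 70 ≤ q2 + q3 + s4) (ht : 3 * t ≤ 3 * 28) (hq2 : 6 * q2 ≤ 3 * 28) (hs6 : s6 ≤ 28) (hs5 : 0 ≤ s5)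
    (hs4 : 0 ≤ s4) : 14 / 5 * u ≤ y := by
  linarith

/-- **`M ⊕ N` at `(7, 4)`**: `M` coloop-free of rank `4` on `8` points and `N` coloop-free of rank `3` on `5` points,
both with all pairs of rank `2` — the shape `(rank 4 on 8) ⊕ (rank 3 on 5)` of the `(7, 6)` cell. -/
theorem c025_seven_four_disjointSum_four_eight_three_five (M N : Matroid α) [M.Finite] [N.Finite]
    (h : Disjoint M.E N.E) (hM : M.eRank = ((4 : ℕ) : ℕ∞)) (hME : M.E.ncard = 8) (hcolM : M.coloops = ∅)
    (hpairsM : ∀ e ∈ M.E, ∀ f ∈ M.E, e ≠ f → M.eRk {e, f} = 2) (hN : N.eRank = ((3 : ℕ) : ℕ∞))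
    (hNE : N.E.ncard = 5) (hcolN : N.coloops = ∅) (hpairsN : ∀ e ∈ N.E, ∀ f ∈ N.E, e ≠ f → N.eRk {e, f} = 2) :
    phiK 7 4 * ({A : Set α | A ⊆ (M.disjointSum N h).E ∧ (M.disjointSum N h).eRk A = ((7 : ℕ) : ℕ∞) ∧
        (M.disjointSum N h).eRk ((M.disjointSum N h).E \ A) = ((4 : ℕ) : ℕ∞)}.ncard : ℚ) ≤
      ({A : Set α | A ⊆ (M.disjointSum N h).E ∧ ((4 : ℕ) : ℕ∞) < (M.disjointSum N h).eRk A ∧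
        (M.disjointSum N h).eRk A < ((7 : ℕ) : ℕ∞)}.ncard : ℚ) := by
  have h42 := ncard_profileSet_four_two_le_rank_four_eight hM hME hcolM
  have h43 := ncard_profileSet_four_three_le_rank_four_eight (M := M) hME
  have h44 := ncard_profileSet_four_four_le_rank_four_eight (M := M) hME
  -- the `U`-side: the slices `(4, 2)`, `(4, 3)`, `(4, 4)`
  have hU : {A : Set α | A ⊆ (M.disjointSum N h).E ∧ (M.disjointSum N h).eRk A = ((7 : ℕ) : ℕ∞) ∧
      (M.disjointSum N h).eRk ((M.disjointSum N h).E \ A) = ((4 : ℕ) : ℕ∞)}.ncard ≤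
      10 * (profileSet M 4 2).ncard + 5 * (profileSet M 4 3).ncard + (profileSet M 4 4).ncard := by
    rw [disjointSum_ncard_U_eq_finsum M N h 7 4, finsum_mem_coe_finset]
    have hsub : ({(4, 2), (4, 3), (4, 4)} : Finset (ℕ × ℕ)) ⊆ Finset.range (7 + 1) ×ˢ Finset.range (4 + 1) := by
      decide
    rw [← Finset.sum_subset hsub ?_]
    · rw [Finset.sum_insert (by decide), Finset.sum_insert (by decide), Finset.sum_singleton]
      dsimp only
      show (profileSet M 4 2).ncard * (profileSet N 3 2).ncard + ((profileSet M 4 3).ncard * (profileSet N 3 1).ncard +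
        (profileSet M 4 4).ncard * (profileSet N 3 0).ncard) ≤ _
      have g32 := ncard_profileSet_le_choose_of_ncard_eq (N := N) (a := 3) (b := 2) hNE
      rw [show Nat.choose (3 + 2) 3 = 10 by decide] at g32
      have g31 := ncard_profileSet_top_one_le_of_pairs' hpairsN 3
      rw [hNE] at g31
      have g30 := ncard_profileSet_top_zero_le_of_pairs N hpairsN (by omega) 3
      have e1 := Nat.mul_le_mul_left (profileSet M 4 2).ncard g32
      have e2 := Nat.mul_le_mul_left (profileSet M 4 3).ncard g31
      have e3 := Nat.mul_le_mul_left (profileSet M 4 4).ncard g30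
      nlinarith [e1, e2, e3]
    · rintro ⟨a, b⟩ hmem hnot
      rw [Finset.mem_product, Finset.mem_range, Finset.mem_range] at hmem
      simp only [Finset.mem_insert, Finset.mem_singleton, Prod.mk.injEq, not_or] at hnot
      dsimp only
      rcases Nat.lt_or_ge 4 a with ha | ha
      · rw [profileSet_eq_empty_of_eRank_lt M hM ha b, ncard_empty, zero_mul]
      rcases Nat.lt_or_ge a 4 with ha' | ha'
      · have h7a : 3 < 7 - a := by omega
        rw [profileSet_eq_empty_of_eRank_lt N hN h7a (4 - b), ncard_empty, mul_zero]
      have ha4 : a = 4 := by omega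
      subst ha4
      rw [show (7 : ℕ) - 4 = 3 from rfl]
      have hb : b < 2 := by omega
      rcases Nat.lt_or_ge b 1 with hb0 | hb1
      · have hb0' : b = 0 := by omega
        subst hb0'
        rw [profileSet_eq_empty_of_eRank_lt_snd N hN (by norm_num) 3, ncard_empty, mul_zero]
      · have hb1' : b = 1 := by omega
        subst hb1'
        -- `N_N(3, 3) = ∅` on `5` points
        rw [profileSet_eq_empty_of_ncard_lt N (by rw [hNE]; norm_num : N.E.ncard < 3 + (4 - 1)), ncard_empty,
          mul_zero]
  -- the `Y`-side: `(2, 3)`, `(3, 2)`, `(3, 3)`, `(4, 1)`, `(4, 2)`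
  have hY : 13 * (rankSet M 2).ncard + 23 * (rankSet M 3).ncard + 15 * (rankSet M 4).ncard ≤
      {A : Set α | A ⊆ (M.disjointSum N h).E ∧ ((4 : ℕ) : ℕ∞) < (M.disjointSum N h).eRk A ∧
        (M.disjointSum N h).eRk A < ((7 : ℕ) : ℕ∞)}.ncard := by
    rw [disjointSum_ncard_Y_eq_finsum M N h 7 4, finsum_mem_coe_finset]
    have hsub : ({(2, 3), (3, 2), (3, 3), (4, 1), (4, 2)} : Finset (ℕ × ℕ)) ⊆
        (Finset.range 7 ×ˢ Finset.range 7).filter (fun x : ℕ × ℕ => 4 < x.1 + x.2 ∧ x.1 + x.2 < 7) := by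
      decide
    refine le_trans ?_ (Finset.sum_le_sum_of_subset hsub)
    rw [Finset.sum_insert (by decide), Finset.sum_insert (by decide), Finset.sum_insert (by decide),
      Finset.sum_insert (by decide), Finset.sum_singleton]
    dsimp only
    have G1 : 5 ≤ (rankSet N 1).ncard := by
      have := ncard_le_ncard_rankSet_one_of_pairs hpairsN (by omega)
      rwa [hNE] at this
    have G2 : 10 ≤ (rankSet N 2).ncard := by
      have := choose_le_ncard_rankSet_two_of_pairs hpairsN
      rwa [hNE, show Nat.choose 5 2 = 10 by decide] at this
    have G3 := ncard_rankSet_three_ge_rank_three_five N hN hNE hcolN hpairsN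
    have e23 := Nat.mul_le_mul_left (rankSet M 2).ncard G3
    have e32 := Nat.mul_le_mul_left (rankSet M 3).ncard G2
    have e33 := Nat.mul_le_mul_left (rankSet M 3).ncard G3
    have e41 := Nat.mul_le_mul_left (rankSet M 4).ncard G1
    have e42 := Nat.mul_le_mul_left (rankSet M 4).ncard G2
    linarith
  obtain ⟨hF2, hF3, hF4⟩ := profile_rank_four_eight hM hME hcolM hpairsM
  have h70 := seventy_le_four_sets_rank_four_eight hM hME hpairsM
  have hcl : ∀ x ∈ M.E, ∀ y ∈ M.E, x ≠ y → (M.closure {x, y}).ncard ≤ 3 + 2 := by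
    intro x hx y hy hxy
    have := ncard_closure_pair_le_of_coloops' M hM (by norm_num) hcolM hpairsM hx hy hxy
    rw [hME] at this
    omega
  have ht := choose_mul_ncard_rankTwoSets_le M hpairsM (c := 3) (m := 3) hcl
  have hq2 := choose_mul_ncard_rankTwoSets_le M hpairsM (c := 3) (m := 4) hcl
  rw [hME, show Nat.choose 3 2 = 3 by decide, show Nat.choose 3 (3 - 2) = 3 by decide,
    show Nat.choose 8 2 = 28 by decide] at ht
  rw [hME, show Nat.choose 4 2 = 6 by decide, show Nat.choose 3 (4 - 2) = 3 by decide,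
    show Nat.choose 8 2 = 28 by decide] at hq2
  have hs6 : {Q : Set α | Q ⊆ M.E ∧ Q.ncard = 6 ∧ M.eRk Q = ((4 : ℕ) : ℕ∞)}.ncard ≤ 28 := by
    have hf6 : {A : Set α | A ⊆ M.E ∧ A.ncard = 6}.Finite := M.ground_finite.finite_subsets.subset (fun _ hA => hA.1)
    have := ncard_le_ncard (show {Q : Set α | Q ⊆ M.E ∧ Q.ncard = 6 ∧ M.eRk Q = ((4 : ℕ) : ℕ∞)} ⊆
      {A : Set α | A ⊆ M.E ∧ A.ncard = 6} from fun A hA => ⟨hA.1, hA.2.1⟩) hf6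
    rwa [ncard_setOf_subset_ncard_eq M.ground_finite 6, hME, show Nat.choose 8 6 = 28 by decide] at this
  have ht56 : (rankTwoSets M 3).ncard ≤ 56 := by omega
  rw [phiK_seven_four]
  have hU' : (({A : Set α | A ⊆ (M.disjointSum N h).E ∧ (M.disjointSum N h).eRk A = ((7 : ℕ) : ℕ∞) ∧
      (M.disjointSum N h).eRk ((M.disjointSum N h).E \ A) = ((4 : ℕ) : ℕ∞)}.ncard : ℕ) : ℚ) ≤
      10 * (({Q : Set α | Q ⊆ M.E ∧ Q.ncard = 6 ∧ M.eRk Q = ((4 : ℕ) : ℕ∞)}.ncard : ℚ) +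
          ((rankTwoSets M 3).ncard : ℚ) + ((rankTwoSets M 4).ncard : ℚ)) +
        5 * (({Q : Set α | Q ⊆ M.E ∧ Q.ncard = 5 ∧ M.eRk Q = ((4 : ℕ) : ℕ∞)}.ncard : ℚ) +
          ({Q : Set α | Q ⊆ M.E ∧ Q.ncard = 4 ∧ M.eRk Q = ((3 : ℕ) : ℕ∞)}.ncard : ℚ)) +
        ({Q : Set α | Q ⊆ M.E ∧ Q.ncard = 4 ∧ M.eRk Q = ((4 : ℕ) : ℕ∞)}.ncard : ℚ) := by
    have hU2 : {A : Set α | A ⊆ (M.disjointSum N h).E ∧ (M.disjointSum N h).eRk A = ((7 : ℕ) : ℕ∞) ∧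
        (M.disjointSum N h).eRk ((M.disjointSum N h).E \ A) = ((4 : ℕ) : ℕ∞)}.ncard ≤
        10 * ({Q : Set α | Q ⊆ M.E ∧ Q.ncard = 6 ∧ M.eRk Q = ((4 : ℕ) : ℕ∞)}.ncard + (rankTwoSets M 3).ncard +
          (rankTwoSets M 4).ncard) +
        5 * ({Q : Set α | Q ⊆ M.E ∧ Q.ncard = 5 ∧ M.eRk Q = ((4 : ℕ) : ℕ∞)}.ncard +
          {Q : Set α | Q ⊆ M.E ∧ Q.ncard = 4 ∧ M.eRk Q = ((3 : ℕ) : ℕ∞)}.ncard) +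
        {Q : Set α | Q ⊆ M.E ∧ Q.ncard = 4 ∧ M.eRk Q = ((4 : ℕ) : ℕ∞)}.ncard := by omega
    exact_mod_cast hU2
  have hY' : 13 * ((rankSet M 2).ncard : ℚ) + 23 * ((rankSet M 3).ncard : ℚ) + 15 * ((rankSet M 4).ncard : ℚ) ≤
      (({A : Set α | A ⊆ (M.disjointSum N h).E ∧ ((4 : ℕ) : ℕ∞) < (M.disjointSum N h).eRk A ∧
        (M.disjointSum N h).eRk A < ((7 : ℕ) : ℕ∞)}.ncard : ℕ) : ℚ) := by
    exact_mod_cast hY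
  have hF3' : (56 : ℚ) - ((rankTwoSets M 3).ncard : ℚ) +
      ({Q : Set α | Q ⊆ M.E ∧ Q.ncard = 4 ∧ M.eRk Q = ((3 : ℕ) : ℕ∞)}.ncard : ℚ) ≤ ((rankSet M 3).ncard : ℚ) := by
    have hc : ((56 - (rankTwoSets M 3).ncard +
        {Q : Set α | Q ⊆ M.E ∧ Q.ncard = 4 ∧ M.eRk Q = ((3 : ℕ) : ℕ∞)}.ncard : ℕ) : ℚ) =
        (56 : ℚ) - ((rankTwoSets M 3).ncard : ℚ) +
          ({Q : Set α | Q ⊆ M.E ∧ Q.ncard = 4 ∧ M.eRk Q = ((3 : ℕ) : ℕ∞)}.ncard : ℚ) := by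
      push_cast [Nat.cast_sub ht56]
      ring
    rw [← hc]
    exact_mod_cast hF3
  exact consumer_arith_four_eight_three_five hU' hY' (by exact_mod_cast hF2) hF3' (by exact_mod_cast hF4)
    (by exact_mod_cast h70) (by exact_mod_cast ht) (by exact_mod_cast hq2) (by exact_mod_cast hs6)
    (Nat.cast_nonneg _) (Nat.cast_nonneg _)

end S1

end PercRepro
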